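import Summits.HubbardSuperconductivity.HubbardSuperconductivity.Theses.ComplexGFFStiffness

/-!
# BC3 birth skeleton — crux `HypALocalTwoPoint` of route `route-HubbardSuperconductivity-ComplexGFFStiffness`

Plan-only line `birth` (crux item stmt-HubbardSuperconductivity-19155, rank 3): the crux splits into
(i) N-uniform NON-VANISHING of the complex partition function along the tower (`ZNonvanishing`; the
representation half of the renormalisation group, [ABKM19] = arXiv:1910.13564 Ch. 4, p.28 of the held
text: 𝒵(Ĥ₀(K₀,q),K₀,q) = ∫(1 + K_N) dμ^{(q)}_{N+1} with ‖K_N‖ ≤ Cη^N exponentially small — read on the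
ι-symmetric class E^ι, |∫(1+K_N)dμ − 1| ≤ ‖K_N‖ < 1 gives Z ≠ 0 for every N; this is the route
header's PLAN-ONLY first rung `stub_zNonvanishing : ZNonvanishing`, shared with the sibling crux
`HypACumulant`) and (ii) the K-uniform O(g) two-point bound GIVEN non-vanishing (`TwoPointGivenZ`;
the smoothness half, [ABKM19] Secs. 10–12, ℓ = 1, along t ↦ t𝒦_g paired with the bounded-range
observable cos(z_i/√K)).

Registrar shape (as `Summits/ABC/ABC/Cruxes/BalancedFamily/Lines/birth.lean`): the composition
`HypALocalTwoPoint_of_stubs : ZNonvanishing → TwoPointGivenZ → <body of HypALocalTwoPoint>` is a REAL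
proof (merge L₀ by `max`, g₀ by `min`; no `sorry` in its closure), and the registered target
`HypALocalTwoPoint_of : HypALocalTwoPoint := HypALocalTwoPoint_of_stubs stub_zNonvanishing
stub_twoPointGivenZ` concludes the crux BY NAME with no hypotheses; `sorry` occurs ONLY in the two
`stub_*` theorems, so `#print axioms HypALocalTwoPoint_of` reaches `sorryAx` exactly through them.
(The stub statements are plain `def`s, not `@[stub]`-tagged: crux workfiles may not carry
gate-reserved attributes, and the by-name target needs none.) Stub probes (inline, farm rc 0,
2026-08-25, planner-xylro-ideate-p3 lineage): no stub cheaply gives the crux or the summit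
(`#h21_crux_probe … summit := HypALocalTwoPoint` / `summit := HubbardSuperconductivity` → CLEAN).
The typed RG interface (finite-range decomposition, norms, the map 𝒯, fine tuning, the Banach space E
of observables) that the stubs' proofs need is the first definition request of the seat that claims
this crux (route header §Not decomposed yet).
-/

-- `Summit.<Summit>.<Problem>`: for the single-conjunct summit the duplicate `HubbardSuperconductivity.HubbardSuperconductivity` is mandated.
set_option linter.dupNamespace false

namespace Summit.HubbardSuperconductivity.HubbardSuperconductivity.Cruxes.HypALocalTwoPoint.Birth

open Literature.MathematicalPhysics.StatisticalMechanics.ComplexGradientGFF4 (Z ev Y D LocalTwoPointAt)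
open Summit.HubbardSuperconductivity.HubbardSuperconductivity.Theses.ComplexGFFStiffness (HypALocalTwoPoint)

/-! ## Stub statements -/

/-- N-uniform non-vanishing of the complex partition function `Z_{L^N}(g,0)` along the tower, for all
large odd `L` and `0 ≤ g ≤ g₀(L)` (shared first stub of both cruxes of the route; the header's
plan-only BC5 rung). -/
def ZNonvanishing : Prop :=
  ∃ L₀ : ℕ, ∀ L : ℕ, Odd L → L₀ ≤ L → ∃ g₀ : ℝ, 0 < g₀ ∧
    ∀ g : ℝ, 0 ≤ g → g ≤ g₀ → ∀ N : ℕ, 1 ≤ N → ∀ (n : ℕ) [NeZero n], n = L ^ N → Z n g 0 ≠ 0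

/-- The N-uniform, K-uniform O(g) bound on the nearest-neighbour cosine two-point function, GIVEN
non-vanishing of `Z` (= [ABKM19] Thm 2.2, ℓ = 1, transcribed to the ι-symmetric complex class, with
`Z ≠ 0` moved into the hypotheses). -/
def TwoPointGivenZ : Prop :=
  ∃ L₀ : ℕ, ∀ L : ℕ, Odd L → L₀ ≤ L → ∃ g₀ C : ℝ, 0 < g₀ ∧
    ∀ g : ℝ, 0 ≤ g → g ≤ g₀ → ∀ N : ℕ, 1 ≤ N → ∀ (n : ℕ) [NeZero n], n = L ^ N → Z n g 0 ≠ 0 →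
      ∀ K : ℝ, 1 ≤ K → ∀ (x : Fin 4 → ZMod n) (i : Fin 4),
        ‖ev n g (fun φ => ((Real.cos (D φ i x / Real.sqrt K) : ℝ) : ℂ))
            - ev n 0 (fun φ => ((Real.cos (D φ i x / Real.sqrt K) : ℝ) : ℂ))‖ ≤ C * g

/-! ## The registered stubs (the ONLY `sorry`s of the file) -/

/-- **Stub 1 — `stub_zNonvanishing` (OPEN; the route header's plan-only first rung; size L).**
Why plausibly true: [ABKM19] Ch. 4 representation `Z = ∫(1+K_N)dμ` with ‖K_N‖ ≤ Cη^N on the real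
class; the bet is that every RG step preserves ι-symmetry so the same representation holds on the
complex ι-symmetric class. Why it might fail: a zero of `Z_{L^N}(g,0)` at fixed small `g` for some
large `N` (Lee–Yang-type accumulation) — exactly the route's kill criterion. -/
theorem stub_zNonvanishing : ZNonvanishing := by
  sorry

/-- **Stub 2 — `stub_twoPointGivenZ` (OPEN; the smoothness half with a bounded-range observable;
size L).** [ABKM19] Secs. 10–12 with the observable extension (arXiv:2007.10869): first-order
dependence on t ↦ t𝒦_g of the expectation of cos(z_i/√K), uniformly in N, given the flow exists.
Why it might fail: cos(z_i/√K)·(1+𝒦_g) must lie in the paper's Banach space E with norm O(1)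
UNIFORMLY in K ≥ 1 (route header, crux docstring). -/
theorem stub_twoPointGivenZ : TwoPointGivenZ := by
  sorry

/-! ## Composition (sorry-free) and the registered target -/

/-- **Composition (kernel-checked, no `sorry` in its closure).** The two stub statements imply the
crux statement — verbatim the body of
`Summit.HubbardSuperconductivity.HubbardSuperconductivity.Theses.ComplexGFFStiffness.HypALocalTwoPoint` —
by merging the thresholds (`L₀ := max`, `g₀ := min`) and feeding the non-vanishing into the
conditional bound. [folklore] -/
theorem HypALocalTwoPoint_of_stubs (h₁ : ZNonvanishing) (h₂ : TwoPointGivenZ) :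
    ∃ L₀ : ℕ, ∀ L : ℕ, Odd L → L₀ ≤ L → ∃ g₀ C : ℝ, 0 < g₀ ∧ LocalTwoPointAt L g₀ C := by
  obtain ⟨L₁, h₁⟩ := h₁
  obtain ⟨L₂, h₂⟩ := h₂
  refine ⟨max L₁ L₂, fun L hL hle => ?_⟩
  obtain ⟨g₁, hg₁, hZ⟩ := h₁ L hL (le_trans (le_max_left _ _) hle)
  obtain ⟨g₂, C, hg₂, hC⟩ := h₂ L hL (le_trans (le_max_right _ _) hle)
  refine ⟨min g₁ g₂, C, lt_min hg₁ hg₂, ?_⟩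
  intro g hg0 hg N hN n _ hn
  have hz : Z n g 0 ≠ 0 := hZ g hg0 (le_trans hg (min_le_left _ _)) N hN n hn
  exact ⟨hz, hC g hg0 (le_trans hg (min_le_right _ _)) N hN n hn hz⟩

/-- **Registered target of the skeleton (BC3).** The crux BY NAME, no hypotheses:
`HypALocalTwoPoint_of_stubs` applied to the two declared stubs; `#print axioms` reaches `sorryAx`
exactly through `stub_zNonvanishing` and `stub_twoPointGivenZ`. This is the theorem
`#h21_check_skeleton` keys on (the only theorem of the file whose conclusion is the crux decl). -/
theorem HypALocalTwoPoint_of : HypALocalTwoPoint :=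
  HypALocalTwoPoint_of_stubs stub_zNonvanishing stub_twoPointGivenZ

end Summit.HubbardSuperconductivity.HubbardSuperconductivity.Cruxes.HypALocalTwoPoint.Birth
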